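import Summits.KontsevichZagierPeriods.KontsevichZagierPeriods.Theses.RootDecompRationalCubeDichotomy
import Literature.ModelTheory.ExponentialFields.SemialgebraicInterior
import Literature.NumberTheory.Transcendental.SemialgebraicAlgebraicPoints
import HarnessLib

/-!
# `NashEtaleCover ⟸ NashEtaleLocal` (route `RootDecompRationalCubeDichotomy`, items 29430 ⟸ 31659)

The support item `NashEtaleCover` (stmt-KontsevichZagierPeriods-29430) asks for ONE grid mesh `1/N` and,
on every grid box, an étale re-presentation `g = A(x,h x)/B(x,h x)` of a `ℚ`-Nash function `g` near the
closed unit cube.  The support item `NashEtaleLocal` (stmt-KontsevichZagierPeriods-31659, born at route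
rev 7) is the same statement AT A POINT: an open neighbourhood `V ∋ x₀` carrying such data (Artin–Mazur /
BCR98 §8.1 / Stacks 00UE).  This file proves the purely topological step

  `nashEtaleCover_of_local : NashEtaleLocal → NashEtaleCover`   (both route decls BY NAME)

(Lebesgue number of the cover of the compact cube in the sup metric of `Fin n → ℝ`, then any `N` with
`1/N` below it; every grid box lies in the ball of radius `1/N` around its lower corner).  So the
algebraic/analytic content of 29430 is exactly 31659.  Also proved: `local_of_simple` (generic points,
any `n`: where a vanishing `P` is already simple the data are `h = g, F = P, A = w, B = 1`) and the
`n = 0` slice `nashEtaleLocal_zero` (a `ℚ`-semialgebraic constant is algebraic; its minimal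
polynomial is separable).

Source: cell `decomp-kz`, lens 2, gen 7, `HOME/decomp-kz-lens-2/g7/NashEtaleCoverGlue.lean`
sha256 82cac9c706bef433 (critic decomp-kz-crit-1 g2 CLEARED 2026-08-30T09:13:02Z), with the lens-local
`def NashEtaleLocal` replaced by the born route decl (no local `def`s: kernel lane); landed by
the census seat decomp-kz-census-1 g7 `--supports stmt-KontsevichZagierPeriods-29430`.  No `sorry`;
standard axioms.  References: [cite: BochnakCosteRoy1998, §8.1]; Stacks Project 00UE.
-/

open Set MvPolynomial
open Literature.NumberTheory.Transcendental

namespace Summit.KontsevichZagierPeriods.RootDecompRationalCubeDichotomy.Rung29430.NashEtaleLocalGlue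

open Summit.KontsevichZagierPeriods.KontsevichZagierPeriods.Theses.RootDecompRationalCubeDichotomy
  (NashEtaleCover NashEtaleLocal)

/-- A grid box of mesh `1/(N+1)` with lower corner `κ/(N+1)` lies in the closed sup-ball of radius
`1/(N+1)` around that corner. -/
theorem dist_corner_le {n N : ℕ} (κ : Fin n → Fin (N + 1)) {x : Fin n → ℝ}
    (hx : x ∈ Set.pi Set.univ (fun i : Fin n =>
      Set.Icc ((((κ i : ℕ) : ℝ)) / ((N + 1 : ℕ) : ℝ)) ((((κ i : ℕ) : ℝ) + 1) / ((N + 1 : ℕ) : ℝ)))) :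
    dist x (fun i => ((κ i : ℕ) : ℝ) / ((N + 1 : ℕ) : ℝ)) ≤ 1 / ((N : ℝ) + 1) := by
  have hN : (0 : ℝ) < (N : ℝ) + 1 := by positivity
  have hN' : ((N + 1 : ℕ) : ℝ) = (N : ℝ) + 1 := by push_cast; ring
  rw [dist_pi_le_iff (by positivity)]
  intro j
  obtain ⟨h1, h2⟩ := hx j (Set.mem_univ j)
  rw [hN'] at h1 h2
  rw [Real.dist_eq, abs_le, hN']
  constructor
  · have : ((κ j : ℕ) : ℝ) / ((N : ℝ) + 1) ≤ x j := h1
    have h0 : (0 : ℝ) ≤ 1 / ((N : ℝ) + 1) := by positivity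
    linarith
  · have : x j ≤ (((κ j : ℕ) : ℝ) + 1) / ((N : ℝ) + 1) := h2
    rw [add_div] at this
    linarith

/-- The lower corner of a grid box of mesh `1/(N+1)` lies in the closed unit cube. -/
theorem corner_mem_cube {n N : ℕ} (κ : Fin n → Fin (N + 1)) :
    (fun i => ((κ i : ℕ) : ℝ) / ((N + 1 : ℕ) : ℝ)) ∈ Set.pi Set.univ (fun _ : Fin n => Set.Icc (0:ℝ) 1) := by
  intro i _
  have hN : (0 : ℝ) < ((N + 1 : ℕ) : ℝ) := by positivity
  have hκ : ((κ i : ℕ) : ℝ) ≤ ((N + 1 : ℕ) : ℝ) := by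
    have := (κ i).isLt
    exact_mod_cast this.le
  refine ⟨by positivity, ?_⟩
  rwa [div_le_one hN]

/-- **`NashEtaleCover ⟸ NashEtaleLocal`** — item 29430 from item 31659, both route decls BY NAME:
at each base dimension `n`, take a Lebesgue number `δ` of the pointwise cover of the compact cube in the
sup metric and any grid mesh `1/(N+1) < δ`; every grid box lies in the ball of radius `1/(N+1)` around
its lower corner. [folklore] -/
theorem nashEtaleCover_of_nashEtaleLocal (hloc : NashEtaleLocal) : NashEtaleCover := by
  intro n g U hU hKU hsa han
  have hloc' := hloc n g U hU hKU hsa han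
  choose V h F A B hV using hloc'
  have hKc : IsCompact (Set.pi Set.univ (fun _ : Fin n => Set.Icc (0:ℝ) 1)) :=
    isCompact_univ_pi fun _ => isCompact_Icc
  obtain ⟨δ, hδ, hcov⟩ := lebesgue_number_lemma_of_metric hKc
    (c := fun i : Set.pi Set.univ (fun _ : Fin n => Set.Icc (0:ℝ) 1) => V i.1 i.2)
    (fun i => (hV i.1 i.2).1)
    (fun x hx => Set.mem_iUnion.mpr ⟨⟨x, hx⟩, (hV x hx).2.1⟩)
  obtain ⟨N, hN⟩ := exists_nat_one_div_lt hδ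
  refine ⟨N + 1, Nat.succ_pos N, fun κ => ?_⟩
  obtain ⟨i, hi⟩ := hcov _ (corner_mem_cube κ)
  have hbox : Set.pi Set.univ (fun j : Fin n =>
      Set.Icc ((((κ j : ℕ) : ℝ)) / ((N + 1 : ℕ) : ℝ)) ((((κ j : ℕ) : ℝ) + 1) / ((N + 1 : ℕ) : ℝ))) ⊆ V i.1 i.2 :=
    fun x hx => hi (Metric.mem_ball.mpr (lt_of_le_of_lt (dist_corner_le κ hx) hN))
  exact ⟨V i.1 i.2, h i.1 i.2, F i.1 i.2, A i.1 i.2, B i.1 i.2, (hV i.1 i.2).1, hbox,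
    (hV i.1 i.2).2.2.1, (hV i.1 i.2).2.2.2.1, fun x hx => (hV i.1 i.2).2.2.2.2 x (hbox hx)⟩

/-- The same edge with the route decls spelled out in the type (gate-visible form):
`Theses.RootDecompRationalCubeDichotomy.NashEtaleLocal → Theses.RootDecompRationalCubeDichotomy.NashEtaleCover`. [folklore] -/
theorem nashEtaleCover_of_local :
    Summit.KontsevichZagierPeriods.KontsevichZagierPeriods.Theses.RootDecompRationalCubeDichotomy.NashEtaleLocal →
      Summit.KontsevichZagierPeriods.KontsevichZagierPeriods.Theses.RootDecompRationalCubeDichotomy.NashEtaleCover :=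
  nashEtaleCover_of_nashEtaleLocal

/-- **Generic points.**  At a point `x₀` where some `P ∈ ℚ[x][w]` vanishing on the graph of `g` over `U`
is already SIMPLE (`∂_w P(x₀, g x₀) ≠ 0`), the pointwise étale re-presentation holds with `h = g`,
`F = P`, `A = w`, `B = 1` on `V = U ∩ {∂_w P(x, g x) ≠ 0}`.  So the content of `NashEtaleLocal` sits at
the `P`-ramified points only (for `n = 1`: finitely many algebraic `x₀`, NODE §C). [folklore] -/
theorem local_of_simple {n : ℕ} {g : (Fin n → ℝ) → ℝ} {U : Set (Fin n → ℝ)} (hU : IsOpen U)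
    (hsa : IsSemialgebraicFunOn ℚ U g) (han : AnalyticOnNhd ℝ g U) {x₀ : Fin n → ℝ} (hx₀ : x₀ ∈ U)
    (P : MvPolynomial (Fin (n + 1)) ℚ)
    (hP : ∀ x ∈ U, MvPolynomial.aeval (Fin.snoc x (g x) : Fin (n + 1) → ℝ) P = 0)
    (hPt : MvPolynomial.aeval (Fin.snoc x₀ (g x₀) : Fin (n + 1) → ℝ)
      (MvPolynomial.pderiv (Fin.last n) P) ≠ 0) :
    ∃ (V : Set (Fin n → ℝ)) (h : (Fin n → ℝ) → ℝ) (F A B : MvPolynomial (Fin (n + 1)) ℚ),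
      IsOpen V ∧ x₀ ∈ V ∧ IsSemialgebraicFunOn ℚ V h ∧ AnalyticOnNhd ℝ h V ∧
      ∀ x ∈ V,
        MvPolynomial.aeval (Fin.snoc x (h x) : Fin (n + 1) → ℝ) F = 0 ∧
        MvPolynomial.aeval (Fin.snoc x (h x) : Fin (n + 1) → ℝ) (MvPolynomial.pderiv (Fin.last n) F) ≠ 0 ∧
        MvPolynomial.aeval (Fin.snoc x (h x) : Fin (n + 1) → ℝ) B ≠ 0 ∧
        g x = MvPolynomial.aeval (Fin.snoc x (h x) : Fin (n + 1) → ℝ) A /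
          MvPolynomial.aeval (Fin.snoc x (h x) : Fin (n + 1) → ℝ) B := by
  set Pt := MvPolynomial.pderiv (Fin.last n) P with hPt_def
  set φ : (Fin n → ℝ) → ℝ := fun x => MvPolynomial.aeval (Fin.snoc x (g x) : Fin (n + 1) → ℝ) Pt
    with hφ
  have hφc : ContinuousOn φ U := by
    have hc : Continuous (fun z : Fin (n + 1) → ℝ => MvPolynomial.aeval z Pt) :=
      continuousOn_univ.mp
        (Literature.ModelTheory.ExponentialFields.analyticOnNhd_aeval Pt).continuousOn
    exact hc.comp_continuousOn
      (ContinuousOn.finSnoc (X := fun _ : Fin (n + 1) => ℝ) continuousOn_id han.continuousOn)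
  refine ⟨U ∩ φ ⁻¹' {c | c ≠ 0}, g, P, X (Fin.last n), 1,
    hφc.isOpen_inter_preimage hU isOpen_ne, ⟨hx₀, hPt⟩, ?_, han.mono inter_subset_left, ?_⟩
  · -- the graph over `V` is the graph over `U` cut by `∂_w P ≠ 0`
    have hset : {z : Fin (n + 1) → ℝ | ∃ x ∈ U ∩ φ ⁻¹' {c | c ≠ 0}, z = Fin.snoc x (g x)} =
        {z : Fin (n + 1) → ℝ | ∃ x ∈ U, z = Fin.snoc x (g x)} ∩
          {z : Fin (n + 1) → ℝ | MvPolynomial.aeval z Pt = 0}ᶜ := by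
      ext z
      simp only [mem_setOf_eq, mem_inter_iff, mem_preimage, mem_compl_iff]
      constructor
      · rintro ⟨x, ⟨hxU, hxφ⟩, rfl⟩
        exact ⟨⟨x, hxU, rfl⟩, hxφ⟩
      · rintro ⟨⟨x, hxU, rfl⟩, hz⟩
        exact ⟨x, ⟨hxU, hz⟩, rfl⟩
    unfold IsSemialgebraicFunOn
    rw [hset]
    exact hsa.inter
      (Literature.ModelTheory.ExponentialFields.isSemialgebraic_setOf_eval_eq_zero Pt).compl
  · rintro x ⟨hxU, hxφ⟩
    refine ⟨hP x hxU, hxφ, by simp, ?_⟩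
    simp

/-- **The `n = 0` slice of item 31659** (`NashEtaleLocal` at base dimension `0`, hence of 29430 at
`n = 0` by the Lebesgue-number step): a `ℚ`-semialgebraic constant is an algebraic number `c`,
re-presented by its (separable) minimal polynomial: `h = c`, `F = minpoly_ℚ(c)(w)`, `A = w`, `B = 1`.
[folklore] -/
theorem nashEtaleLocal_zero (g : (Fin 0 → ℝ) → ℝ) (U : Set (Fin 0 → ℝ)) (hU : IsOpen U)
    (hKU : Set.pi Set.univ (fun _ : Fin 0 => Set.Icc (0:ℝ) 1) ⊆ U)
    (hsa : IsSemialgebraicFunOn ℚ U g) (han : AnalyticOnNhd ℝ g U)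
    (x₀ : Fin 0 → ℝ) (hx₀ : x₀ ∈ Set.pi Set.univ (fun _ : Fin 0 => Set.Icc (0:ℝ) 1)) :
    ∃ (V : Set (Fin 0 → ℝ)) (h : (Fin 0 → ℝ) → ℝ) (F A B : MvPolynomial (Fin (0 + 1)) ℚ),
      IsOpen V ∧ x₀ ∈ V ∧ IsSemialgebraicFunOn ℚ V h ∧ AnalyticOnNhd ℝ h V ∧
      ∀ x ∈ V,
        MvPolynomial.aeval (Fin.snoc x (h x) : Fin (0 + 1) → ℝ) F = 0 ∧
        MvPolynomial.aeval (Fin.snoc x (h x) : Fin (0 + 1) → ℝ) (MvPolynomial.pderiv (Fin.last 0) F) ≠ 0 ∧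
        MvPolynomial.aeval (Fin.snoc x (h x) : Fin (0 + 1) → ℝ) B ≠ 0 ∧
        g x = MvPolynomial.aeval (Fin.snoc x (h x) : Fin (0 + 1) → ℝ) A /
          MvPolynomial.aeval (Fin.snoc x (h x) : Fin (0 + 1) → ℝ) B := by
  have hx₀U : x₀ ∈ U := hKU hx₀
  have halg : IsAlgebraic ℚ (g x₀) := hsa.isAlgebraic_apply hx₀U (fun i => i.elim0)
  have hint : IsIntegral ℚ (g x₀) := halg.isIntegral
  set p : Polynomial ℚ := minpoly ℚ (g x₀) with hp
  have hgc : ∀ x : Fin 0 → ℝ, g x = g x₀ := fun x => by rw [Subsingleton.elim x x₀]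
  have hFz : ∀ (q : Polynomial ℚ) (z : Fin 1 → ℝ),
      MvPolynomial.aeval z (Polynomial.aeval (X (Fin.last 0) : MvPolynomial (Fin 1) ℚ) q) =
        Polynomial.aeval (z (Fin.last 0)) q := by
    intro q z
    rw [← Polynomial.aeval_algHom_apply, MvPolynomial.aeval_X]
  have hFd : MvPolynomial.pderiv (Fin.last 0)
      (Polynomial.aeval (X (Fin.last 0) : MvPolynomial (Fin 1) ℚ) p) =
        Polynomial.aeval (X (Fin.last 0) : MvPolynomial (Fin 1) ℚ) (Polynomial.derivative p) := by
    rw [Derivation.map_aeval, MvPolynomial.pderiv_X_self, smul_eq_mul, mul_one]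
  refine ⟨U, g, Polynomial.aeval (X (Fin.last 0) : MvPolynomial (Fin 1) ℚ) p, X (Fin.last 0), 1,
    hU, hx₀U, hsa, han, fun x _ => ⟨?_, ?_, by simp, ?_⟩⟩
  · rw [hFz, Fin.snoc_last, hgc x, hp]
    exact minpoly.aeval ℚ (g x₀)
  · rw [hFd, hFz, Fin.snoc_last, hgc x, hp]
    exact (minpoly.irreducible hint).separable.aeval_derivative_ne_zero (minpoly.aeval ℚ (g x₀))
  · rw [MvPolynomial.aeval_X, map_one, div_one, Fin.snoc_last]

end Summit.KontsevichZagierPeriods.RootDecompRationalCubeDichotomy.Rung29430.NashEtaleLocalGlue
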